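import Summits.NavierStokesRegularity.NavierStokesRegularity.Theses.QuantisedSymmetry
import Summits.NavierStokesRegularity.NavierStokesRegularity.Theses.Blowup
import Summits.NavierStokesRegularity.NavierStokesRegularity.Theorems.QuantisedSymmetryPolyhedralTruncationBridge
import Summits.NavierStokesRegularity.NavierStokesRegularity.Theorems.QuantisedSymmetryPolyhedralDssProfileExistsDominatesBlowupProfile
import Summits.NavierStokesRegularity.NavierStokesRegularity.Theorems.QuantisedSymmetryLiouvilleKillsProfile
import HarnessLib

/-!
# Strategist sketch s20-g2 (family `s`, gen 2, independent census) for crux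
`QuantisedSymmetry.PolyhedralDssProfileExists` (stmt-NavierStokesRegularity-1404)

Companion to `Cruxes/PolyhedralDssProfileExists/STRATEGY-CENSUS-s20.md` (gen 2).
Only kernel-checked bookkeeping: (1) the crux ALONE decides the summit negatively with tree theorems
(`crux_decides`); (2) the weaker-intermediate chain X⁻ ⇒ `Blowup.BlowupTypeIDssProfile` (still deciding);
(3) the one honest typed split found (`SubA` = failure of the polyhedral Type-I Liouville theorem,
`SubB` = closing lemma "a Type-I ancient polyhedral solution can be made discretely self-similar"),
with its (trivial-seam) assembly `crux_of_subs` and the converse edge `subA_of_crux` (tree theorem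
`quantisedSymmetry_liouvilleKillsProfile_proof`), recording that `SubA` is strictly on the near side of
the crux while `SubB` carries the whole existence content. No stubs, no sorries; nothing here is a line.
-/

namespace Summit.NavierStokesRegularity.NavierStokesRegularity.Cruxes.PolyhedralDssProfileExists.StrategistS20g2

open Summit.NavierStokesRegularity.NavierStokesRegularity.Theses.QuantisedSymmetry
open Summit.NavierStokesRegularity.NavierStokesRegularity

/-- (1) The crux alone refutes the summit statement: both other binders of `closes` are tree theorems. -/
theorem crux_decides (hX : PolyhedralDssProfileExists) : ¬ _root_.NavierStokesRegularity :=
  closes hX Theorems.quantisedSymmetry_polyhedralTruncationBridge_proof ClayUniqueness_holds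

/-- (2) Weaker-intermediate chain, first link: X⁻ ⇒ route Blowup's crux stmt-0155 (tree theorem, restated). -/
theorem crux_imp_blowupTypeIDssProfile (hX : PolyhedralDssProfileExists) :
    Theses.Blowup.BlowupTypeIDssProfile :=
  Theorems.PolyhedralDssProfileExists.PolyhedralCell.stub_dominatesBlowupProfile hX

/-- (3a) Near-side piece: the polyhedral Type-I Liouville theorem FAILS (some finite irreducible
G ≤ SO(3) and a nontrivial bounded ancient mild Type-I G-equivariant solution — not necessarily DSS). -/
def SubA : Prop := ¬ PolyhedralTypeILiouville

/-- (3b) Far-side piece ("closing lemma"): from any failure of the polyhedral Liouville theorem one can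
produce a DISCRETELY SELF-SIMILAR failure, i.e. the crux. This carries the entire ∃-content. -/
def SubB : Prop := SubA → PolyhedralDssProfileExists

/-- Assembly of the split (modus ponens; `trivial_seam`). -/
theorem crux_of_subs (hA : SubA) (hB : SubB) : PolyhedralDssProfileExists := hB hA

/-- Converse edge: the crux implies `SubA` (tree theorem stmt-1408 `LiouvilleKillsProfile`). Hence
`SubA` is a CONSEQUENCE of the crux, `SubB` is `SubA → X⁻`, and `SubA ∧ SubB ↔ X⁻`. -/
theorem subA_of_crux (hX : PolyhedralDssProfileExists) : SubA :=
  fun hL => Theorems.quantisedSymmetry_liouvilleKillsProfile_proof hL hX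

theorem split_iff : (SubA ∧ SubB) ↔ PolyhedralDssProfileExists :=
  ⟨fun h => h.2 h.1, fun hX => ⟨subA_of_crux hX, fun _ => hX⟩⟩

end Summit.NavierStokesRegularity.NavierStokesRegularity.Cruxes.PolyhedralDssProfileExists.StrategistS20g2
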